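import Mathlib.Data.Real.Basic
import Mathlib.Tactic.Linarith
import Mathlib.Tactic.Ring
import Mathlib.Tactic.Positivity
import HarnessLib

/-!
# `NoHeavyLowerTail` (stmt-CriticalPhenomena-4575) — AG⁺ one-coordinate deletion/contraction bracket: exact formula and the automatic cases

Support file (prover prim-ineq-gen-1 gen 3, new-inequality factory; `--supports stmt-CriticalPhenomena-4575`).  Pure algebra over a
commutative ring / an ordered field: no measure theory, no definitions, no named facts, no sorries.

SETTING (Gladkov's abstract sunflower, the frame of `…AntipodalStrongHarris`, `…KernelRows`, `…ThreeCopyFibre`): a monotone labeling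
`λ : {0,1}^n → {B < C₁,C₂,C₃ < A}` (three up-sets `A ∪ Cᵢ` with pairwise intersections `A`; for percolation: `A` = three terminals joined,
`Cᵢ` = exactly pair `i` joined, `B` = all separate) and a product measure.  Splitting off one coordinate (= one edge, deletion/contraction)
gives the nested pair `λ⁰ ≤ λ¹` of restrictions and the twelve COUPLING CELLS (masses of `{λ⁰ = ℓ, λ¹ = ℓ'}`, `ℓ ≤ ℓ'`):
`b0 = (B,B)`, `cmᵢ = (B,Cᵢ)`, `d = (B,A)`, `cᵢ = (Cᵢ,Cᵢ)`, `cpᵢ = (Cᵢ,A)`, `a0 = (A,A)` (Gladkov's `b₀, cᵢ⁻, d, cᵢ°, cᵢ⁺, a₀`).  With the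
coordinate open with probability `p` the law `(t,u₁,u₂,u₃,q)` (`t = μ(A)`, `uᵢ = μ(Cᵢ)`, `q = μ(B)`) is
`t = a0 + p(d + Σcp)`, `uᵢ = cᵢ + p·cmᵢ + (1−p)·cpᵢ`, `q = b0 + (1−p)(d + Σcm)`; `p = 0` / `p = 1` are the laws of `λ⁰` / `λ¹`.

WHAT.  For the cubic row `AG⁺ = t q − e₂(u) − e₃(u)` (Gladkov–prim 'G3', ⟹ SHK3⁺ = Sahi E₃ of the pairwise separations) the deletion/contraction
BRACKET `B(p) := AG⁺(law p) − (1−p)·AG⁺(law 0) − p·AG⁺(law 1)` has the exact form (`agPlus_coordinate_bracket`)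
    `B(p) = p(1−p)·[ Γ + (c₃+cp₃)x₁x₂ + (c₂+cp₂)x₁x₃ + (c₁+cp₁)x₂x₃ + (1+p)·x₁x₂x₃ ]`,   `xᵢ := cmᵢ − cpᵢ` (increment of petal mass `uᵢ`),
    `Γ := d² + d(Σcp + Σcm) + e₂(cp) + e₂(cm) + Σ cpᵢcmᵢ ≥ 0`  (Gladkov's quadratic-in-`p` certificate `Γ = −AG(law 1 − law 0)`, `gladkovGamma_eq_neg_ag_increment`),
and the mirror form around `p = 1` (`agPlus_coordinate_bracket'`).  Consequently the one-coordinate induction step for AG⁺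
(`AG⁺(law p) ≥ (1−p)AG⁺(law 0) + p·AG⁺(law 1)`) is AUTOMATIC whenever the three petal increments have a common sign
(`agPlus_bracket_nonneg_of_increments_nonneg`, `…_of_increments_nonpos`) or at most one petal mass changes (`…_of_single_increment`);
the terminal–terminal and pendant apex steps of `…CubicThreePointEasySteps` (prim-ineq-gen-2) are the graph instances `(x₁,x₂,x₃) = (q,−u₂,−u₃)`
resp. `(v₁,v₂,−T)`-type of the first identity.  A coordinate with a NEGATIVE bracket must have `Γ` small and increments of mixed sign — the
'rainbow' obstruction of the factory memo FINDING-6 (run/shared/lean/prim/prim-ineq-gen-1/), where the abstract EXISTS-GOOD-COORDINATE statistic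
is 100 % on {0,1}^4,5,6 (74k cases) while no single-coordinate rule is valid.
Numerics behind the file: the two identities and `Γ = −AG(Δ)` verified in exact rational arithmetic on 200 random points (lab/bracketdiag.py: 1e-16 on
2 300 abstract sunflower laws).  [cite: Gladkov2024StrongFKG, proof of Thm 2.1 (cells `a₀,b₀,cᵢ^±,cᵢ°,d` and the coefficient of `p²`)]
-/

namespace Summit.CriticalPhenomena.PercolationContinuityZ3.Theorems

namespace CubicThreePointStep

namespace CoordinateBracket

section Identities

variable {R : Type*} [CommRing R]

/-- **AG⁺ coordinate bracket, expansion around `p = 0`.**  With the twelve coupling cells of a nested pair `λ⁰ ≤ λ¹` and the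
interpolated law `t = a0 + p(d+Σcp)`, `uᵢ = cᵢ + p cmᵢ + (1−p)cpᵢ`, `q = b0 + (1−p)(d+Σcm)`:
`AG⁺(p) − (1−p)AG⁺(0) − p·AG⁺(1) = p(1−p)[Γ + (c₃+cp₃)x₁x₂ + (c₂+cp₂)x₁x₃ + (c₁+cp₁)x₂x₃ + (1+p)x₁x₂x₃]`, `xᵢ = cmᵢ − cpᵢ`,
`Γ = d² + d(Σcp+Σcm) + e₂(cp) + e₂(cm) + Σcpᵢcmᵢ`, where `AG⁺(t,u,q) = tq − e₂(u) − e₃(u)` (polynomial identity). [this work] -/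
theorem agPlus_coordinate_bracket (b0 cm₁ cm₂ cm₃ d c₁ c₂ c₃ cp₁ cp₂ cp₃ a0 p : R) :
    ((a0 + p * (d + cp₁ + cp₂ + cp₃)) * (b0 + (1 - p) * (d + cm₁ + cm₂ + cm₃))
        - ((c₁ + p * cm₁ + (1 - p) * cp₁) * (c₂ + p * cm₂ + (1 - p) * cp₂)
            + (c₁ + p * cm₁ + (1 - p) * cp₁) * (c₃ + p * cm₃ + (1 - p) * cp₃)
            + (c₂ + p * cm₂ + (1 - p) * cp₂) * (c₃ + p * cm₃ + (1 - p) * cp₃))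
        - (c₁ + p * cm₁ + (1 - p) * cp₁) * (c₂ + p * cm₂ + (1 - p) * cp₂) * (c₃ + p * cm₃ + (1 - p) * cp₃))
      - (1 - p) * (a0 * (b0 + d + cm₁ + cm₂ + cm₃)
          - ((c₁ + cp₁) * (c₂ + cp₂) + (c₁ + cp₁) * (c₃ + cp₃) + (c₂ + cp₂) * (c₃ + cp₃))
          - (c₁ + cp₁) * (c₂ + cp₂) * (c₃ + cp₃))
      - p * ((a0 + d + cp₁ + cp₂ + cp₃) * b0
          - ((c₁ + cm₁) * (c₂ + cm₂) + (c₁ + cm₁) * (c₃ + cm₃) + (c₂ + cm₂) * (c₃ + cm₃))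
          - (c₁ + cm₁) * (c₂ + cm₂) * (c₃ + cm₃))
    = p * (1 - p) *
        ((d * d + d * (cp₁ + cp₂ + cp₃ + cm₁ + cm₂ + cm₃) + (cp₁ * cp₂ + cp₁ * cp₃ + cp₂ * cp₃)
            + (cm₁ * cm₂ + cm₁ * cm₃ + cm₂ * cm₃) + (cp₁ * cm₁ + cp₂ * cm₂ + cp₃ * cm₃))
          + (c₃ + cp₃) * (cm₁ - cp₁) * (cm₂ - cp₂) + (c₂ + cp₂) * (cm₁ - cp₁) * (cm₃ - cp₃)
          + (c₁ + cp₁) * (cm₂ - cp₂) * (cm₃ - cp₃)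
          + (1 + p) * ((cm₁ - cp₁) * (cm₂ - cp₂) * (cm₃ - cp₃))) := by
  ring

/-- **AG⁺ coordinate bracket, mirror expansion around `p = 1`** (same left-hand side):
`… = p(1−p)[Γ + (c₃+cm₃)x₁x₂ + (c₂+cm₂)x₁x₃ + (c₁+cm₁)x₂x₃ − (2−p)x₁x₂x₃]`. [this work] -/
theorem agPlus_coordinate_bracket' (b0 cm₁ cm₂ cm₃ d c₁ c₂ c₃ cp₁ cp₂ cp₃ a0 p : R) :
    ((a0 + p * (d + cp₁ + cp₂ + cp₃)) * (b0 + (1 - p) * (d + cm₁ + cm₂ + cm₃))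
        - ((c₁ + p * cm₁ + (1 - p) * cp₁) * (c₂ + p * cm₂ + (1 - p) * cp₂)
            + (c₁ + p * cm₁ + (1 - p) * cp₁) * (c₃ + p * cm₃ + (1 - p) * cp₃)
            + (c₂ + p * cm₂ + (1 - p) * cp₂) * (c₃ + p * cm₃ + (1 - p) * cp₃))
        - (c₁ + p * cm₁ + (1 - p) * cp₁) * (c₂ + p * cm₂ + (1 - p) * cp₂) * (c₃ + p * cm₃ + (1 - p) * cp₃))
      - (1 - p) * (a0 * (b0 + d + cm₁ + cm₂ + cm₃)
          - ((c₁ + cp₁) * (c₂ + cp₂) + (c₁ + cp₁) * (c₃ + cp₃) + (c₂ + cp₂) * (c₃ + cp₃))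
          - (c₁ + cp₁) * (c₂ + cp₂) * (c₃ + cp₃))
      - p * ((a0 + d + cp₁ + cp₂ + cp₃) * b0
          - ((c₁ + cm₁) * (c₂ + cm₂) + (c₁ + cm₁) * (c₃ + cm₃) + (c₂ + cm₂) * (c₃ + cm₃))
          - (c₁ + cm₁) * (c₂ + cm₂) * (c₃ + cm₃))
    = p * (1 - p) *
        ((d * d + d * (cp₁ + cp₂ + cp₃ + cm₁ + cm₂ + cm₃) + (cp₁ * cp₂ + cp₁ * cp₃ + cp₂ * cp₃)
            + (cm₁ * cm₂ + cm₁ * cm₃ + cm₂ * cm₃) + (cp₁ * cm₁ + cp₂ * cm₂ + cp₃ * cm₃))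
          + (c₃ + cm₃) * (cm₁ - cp₁) * (cm₂ - cp₂) + (c₂ + cm₂) * (cm₁ - cp₁) * (cm₃ - cp₃)
          + (c₁ + cm₁) * (cm₂ - cp₂) * (cm₃ - cp₃)
          - (2 - p) * ((cm₁ - cp₁) * (cm₂ - cp₂) * (cm₃ - cp₃))) := by
  ring

/-- **Gladkov's `Γ` is minus the quadratic row at the increment**: with `Δt = d + Σcp`, `Δuᵢ = cmᵢ − cpᵢ`, `Δq = −(d + Σcm)`
(the law increment `law 1 − law 0`), `−(Δt·Δq − e₂(Δu)) = d² + d(Σcp+Σcm) + e₂(cp) + e₂(cm) + Σcpᵢcmᵢ`.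
[cite: Gladkov2024StrongFKG, proof of Thm 2.1] -/
theorem gladkovGamma_eq_neg_ag_increment (cm₁ cm₂ cm₃ d cp₁ cp₂ cp₃ : R) :
    -((d + cp₁ + cp₂ + cp₃) * (-(d + cm₁ + cm₂ + cm₃))
        - ((cm₁ - cp₁) * (cm₂ - cp₂) + (cm₁ - cp₁) * (cm₃ - cp₃) + (cm₂ - cp₂) * (cm₃ - cp₃)))
    = d * d + d * (cp₁ + cp₂ + cp₃ + cm₁ + cm₂ + cm₃) + (cp₁ * cp₂ + cp₁ * cp₃ + cp₂ * cp₃)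
        + (cm₁ * cm₂ + cm₁ * cm₃ + cm₂ * cm₃) + (cp₁ * cm₁ + cp₂ * cm₂ + cp₃ * cm₃) := by
  ring

end Identities

section Signs


/-- **`Γ ≥ 0` for nonnegative cells** (Gladkov's sign step). [cite: Gladkov2024StrongFKG, proof of Thm 2.1] -/
theorem gladkovGamma_nonneg {cm₁ cm₂ cm₃ d cp₁ cp₂ cp₃ : ℝ} (hcm₁ : 0 ≤ cm₁) (hcm₂ : 0 ≤ cm₂) (hcm₃ : 0 ≤ cm₃)
    (hd : 0 ≤ d) (hcp₁ : 0 ≤ cp₁) (hcp₂ : 0 ≤ cp₂) (hcp₃ : 0 ≤ cp₃) :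
    0 ≤ d * d + d * (cp₁ + cp₂ + cp₃ + cm₁ + cm₂ + cm₃) + (cp₁ * cp₂ + cp₁ * cp₃ + cp₂ * cp₃)
        + (cm₁ * cm₂ + cm₁ * cm₃ + cm₂ * cm₃) + (cp₁ * cm₁ + cp₂ * cm₂ + cp₃ * cm₃) := by
  positivity

/-- **Automatic step, increments of a common sign (all `≥ 0`).**  If every petal gains at least as much mass from `B` as it loses to `A`
(`cmᵢ = cpᵢ + xᵢ`, `xᵢ ≥ 0`), the AG⁺ bracket is nonnegative for every `p ∈ [0,1]`:
`AG⁺(law p) ≥ (1−p)·AG⁺(law 0) + p·AG⁺(law 1)` — stated as `0 ≤ bracket`. [this work] -/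
theorem agPlus_bracket_nonneg_of_increments_nonneg {b0 d c₁ c₂ c₃ cp₁ cp₂ cp₃ x₁ x₂ x₃ a0 p : ℝ}
    (hd : 0 ≤ d) (hc₁ : 0 ≤ c₁) (hc₂ : 0 ≤ c₂) (hc₃ : 0 ≤ c₃) (hcp₁ : 0 ≤ cp₁) (hcp₂ : 0 ≤ cp₂) (hcp₃ : 0 ≤ cp₃)
    (hx₁ : 0 ≤ x₁) (hx₂ : 0 ≤ x₂) (hx₃ : 0 ≤ x₃) (hp₀ : 0 ≤ p) (hp₁ : p ≤ 1) :
    0 ≤ ((a0 + p * (d + cp₁ + cp₂ + cp₃)) * (b0 + (1 - p) * (d + (cp₁ + x₁) + (cp₂ + x₂) + (cp₃ + x₃)))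
        - ((c₁ + p * (cp₁ + x₁) + (1 - p) * cp₁) * (c₂ + p * (cp₂ + x₂) + (1 - p) * cp₂)
            + (c₁ + p * (cp₁ + x₁) + (1 - p) * cp₁) * (c₃ + p * (cp₃ + x₃) + (1 - p) * cp₃)
            + (c₂ + p * (cp₂ + x₂) + (1 - p) * cp₂) * (c₃ + p * (cp₃ + x₃) + (1 - p) * cp₃))
        - (c₁ + p * (cp₁ + x₁) + (1 - p) * cp₁) * (c₂ + p * (cp₂ + x₂) + (1 - p) * cp₂)
            * (c₃ + p * (cp₃ + x₃) + (1 - p) * cp₃))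
      - (1 - p) * (a0 * (b0 + d + (cp₁ + x₁) + (cp₂ + x₂) + (cp₃ + x₃))
          - ((c₁ + cp₁) * (c₂ + cp₂) + (c₁ + cp₁) * (c₃ + cp₃) + (c₂ + cp₂) * (c₃ + cp₃))
          - (c₁ + cp₁) * (c₂ + cp₂) * (c₃ + cp₃))
      - p * ((a0 + d + cp₁ + cp₂ + cp₃) * b0
          - ((c₁ + (cp₁ + x₁)) * (c₂ + (cp₂ + x₂)) + (c₁ + (cp₁ + x₁)) * (c₃ + (cp₃ + x₃))
              + (c₂ + (cp₂ + x₂)) * (c₃ + (cp₃ + x₃)))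
          - (c₁ + (cp₁ + x₁)) * (c₂ + (cp₂ + x₂)) * (c₃ + (cp₃ + x₃))) := by
  have key := agPlus_coordinate_bracket b0 (cp₁ + x₁) (cp₂ + x₂) (cp₃ + x₃) d c₁ c₂ c₃ cp₁ cp₂ cp₃ a0 p
  rw [key]
  have h1p : 0 ≤ 1 - p := sub_nonneg.mpr hp₁
  have hx₁' : cp₁ + x₁ - cp₁ = x₁ := by ring
  have hx₂' : cp₂ + x₂ - cp₂ = x₂ := by ring
  have hx₃' : cp₃ + x₃ - cp₃ = x₃ := by ring
  rw [hx₁', hx₂', hx₃']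
  have hcm₁ : 0 ≤ cp₁ + x₁ := by positivity
  have hcm₂ : 0 ≤ cp₂ + x₂ := by positivity
  have hcm₃ : 0 ≤ cp₃ + x₃ := by positivity
  have hΓ := gladkovGamma_nonneg hcm₁ hcm₂ hcm₃ hd hcp₁ hcp₂ hcp₃
  have hB : 0 ≤ (d * d + d * (cp₁ + cp₂ + cp₃ + (cp₁ + x₁) + (cp₂ + x₂) + (cp₃ + x₃))
        + (cp₁ * cp₂ + cp₁ * cp₃ + cp₂ * cp₃)
        + ((cp₁ + x₁) * (cp₂ + x₂) + (cp₁ + x₁) * (cp₃ + x₃) + (cp₂ + x₂) * (cp₃ + x₃))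
        + (cp₁ * (cp₁ + x₁) + cp₂ * (cp₂ + x₂) + cp₃ * (cp₃ + x₃)))
      + (c₃ + cp₃) * x₁ * x₂ + (c₂ + cp₂) * x₁ * x₃ + (c₁ + cp₁) * x₂ * x₃ + (1 + p) * (x₁ * x₂ * x₃) := by
    positivity
  exact mul_nonneg (mul_nonneg hp₀ h1p) hB

/-- **Automatic step, increments of a common sign (all `≤ 0`).**  If every petal loses at least as much mass to `A` as it gains from `B`
(`cpᵢ = cmᵢ + yᵢ`, `yᵢ ≥ 0`), the AG⁺ bracket is nonnegative for every `p ∈ [0,1]` (mirror identity; the cubic term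
`−(2−p)·x₁x₂x₃ = (2−p)·y₁y₂y₃ ≥ 0`). [this work] -/
theorem agPlus_bracket_nonneg_of_increments_nonpos {b0 d c₁ c₂ c₃ cm₁ cm₂ cm₃ y₁ y₂ y₃ a0 p : ℝ}
    (hd : 0 ≤ d) (hc₁ : 0 ≤ c₁) (hc₂ : 0 ≤ c₂) (hc₃ : 0 ≤ c₃) (hcm₁ : 0 ≤ cm₁) (hcm₂ : 0 ≤ cm₂) (hcm₃ : 0 ≤ cm₃)
    (hy₁ : 0 ≤ y₁) (hy₂ : 0 ≤ y₂) (hy₃ : 0 ≤ y₃) (hp₀ : 0 ≤ p) (hp₁ : p ≤ 1) :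
    0 ≤ ((a0 + p * (d + (cm₁ + y₁) + (cm₂ + y₂) + (cm₃ + y₃))) * (b0 + (1 - p) * (d + cm₁ + cm₂ + cm₃))
        - ((c₁ + p * cm₁ + (1 - p) * (cm₁ + y₁)) * (c₂ + p * cm₂ + (1 - p) * (cm₂ + y₂))
            + (c₁ + p * cm₁ + (1 - p) * (cm₁ + y₁)) * (c₃ + p * cm₃ + (1 - p) * (cm₃ + y₃))
            + (c₂ + p * cm₂ + (1 - p) * (cm₂ + y₂)) * (c₃ + p * cm₃ + (1 - p) * (cm₃ + y₃)))
        - (c₁ + p * cm₁ + (1 - p) * (cm₁ + y₁)) * (c₂ + p * cm₂ + (1 - p) * (cm₂ + y₂))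
            * (c₃ + p * cm₃ + (1 - p) * (cm₃ + y₃)))
      - (1 - p) * (a0 * (b0 + d + cm₁ + cm₂ + cm₃)
          - ((c₁ + (cm₁ + y₁)) * (c₂ + (cm₂ + y₂)) + (c₁ + (cm₁ + y₁)) * (c₃ + (cm₃ + y₃))
              + (c₂ + (cm₂ + y₂)) * (c₃ + (cm₃ + y₃)))
          - (c₁ + (cm₁ + y₁)) * (c₂ + (cm₂ + y₂)) * (c₃ + (cm₃ + y₃)))
      - p * ((a0 + d + (cm₁ + y₁) + (cm₂ + y₂) + (cm₃ + y₃)) * b0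
          - ((c₁ + cm₁) * (c₂ + cm₂) + (c₁ + cm₁) * (c₃ + cm₃) + (c₂ + cm₂) * (c₃ + cm₃))
          - (c₁ + cm₁) * (c₂ + cm₂) * (c₃ + cm₃)) := by
  have key := agPlus_coordinate_bracket' b0 cm₁ cm₂ cm₃ d c₁ c₂ c₃ (cm₁ + y₁) (cm₂ + y₂) (cm₃ + y₃) a0 p
  rw [key]
  have h1p : 0 ≤ 1 - p := sub_nonneg.mpr hp₁
  have h2p : 0 ≤ 2 - p := by linarith
  have hx₁' : cm₁ - (cm₁ + y₁) = -y₁ := by ring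
  have hx₂' : cm₂ - (cm₂ + y₂) = -y₂ := by ring
  have hx₃' : cm₃ - (cm₃ + y₃) = -y₃ := by ring
  rw [hx₁', hx₂', hx₃']
  have hcp₁ : 0 ≤ cm₁ + y₁ := by positivity
  have hcp₂ : 0 ≤ cm₂ + y₂ := by positivity
  have hcp₃ : 0 ≤ cm₃ + y₃ := by positivity
  have hB : 0 ≤ (d * d + d * ((cm₁ + y₁) + (cm₂ + y₂) + (cm₃ + y₃) + cm₁ + cm₂ + cm₃)
        + ((cm₁ + y₁) * (cm₂ + y₂) + (cm₁ + y₁) * (cm₃ + y₃) + (cm₂ + y₂) * (cm₃ + y₃))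
        + (cm₁ * cm₂ + cm₁ * cm₃ + cm₂ * cm₃)
        + ((cm₁ + y₁) * cm₁ + (cm₂ + y₂) * cm₂ + (cm₃ + y₃) * cm₃))
      + (c₃ + cm₃) * y₁ * y₂ + (c₂ + cm₂) * y₁ * y₃ + (c₁ + cm₁) * y₂ * y₃ + (2 - p) * (y₁ * y₂ * y₃) := by
    have h2 : 0 ≤ (2 - p) * (y₁ * y₂ * y₃) := mul_nonneg h2p (by positivity)
    have h3 : 0 ≤ (d * d + d * ((cm₁ + y₁) + (cm₂ + y₂) + (cm₃ + y₃) + cm₁ + cm₂ + cm₃)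
        + ((cm₁ + y₁) * (cm₂ + y₂) + (cm₁ + y₁) * (cm₃ + y₃) + (cm₂ + y₂) * (cm₃ + y₃))
        + (cm₁ * cm₂ + cm₁ * cm₃ + cm₂ * cm₃)
        + ((cm₁ + y₁) * cm₁ + (cm₂ + y₂) * cm₂ + (cm₃ + y₃) * cm₃))
      + (c₃ + cm₃) * y₁ * y₂ + (c₂ + cm₂) * y₁ * y₃ + (c₁ + cm₁) * y₂ * y₃ := by positivity
    linarith
  have hrw : (d * d + d * ((cm₁ + y₁) + (cm₂ + y₂) + (cm₃ + y₃) + cm₁ + cm₂ + cm₃)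
        + ((cm₁ + y₁) * (cm₂ + y₂) + (cm₁ + y₁) * (cm₃ + y₃) + (cm₂ + y₂) * (cm₃ + y₃))
        + (cm₁ * cm₂ + cm₁ * cm₃ + cm₂ * cm₃)
        + ((cm₁ + y₁) * cm₁ + (cm₂ + y₂) * cm₂ + (cm₃ + y₃) * cm₃))
      + (c₃ + cm₃) * (-y₁) * (-y₂) + (c₂ + cm₂) * (-y₁) * (-y₃) + (c₁ + cm₁) * (-y₂) * (-y₃)
      - (2 - p) * ((-y₁) * (-y₂) * (-y₃))
      = (d * d + d * ((cm₁ + y₁) + (cm₂ + y₂) + (cm₃ + y₃) + cm₁ + cm₂ + cm₃)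
        + ((cm₁ + y₁) * (cm₂ + y₂) + (cm₁ + y₁) * (cm₃ + y₃) + (cm₂ + y₂) * (cm₃ + y₃))
        + (cm₁ * cm₂ + cm₁ * cm₃ + cm₂ * cm₃)
        + ((cm₁ + y₁) * cm₁ + (cm₂ + y₂) * cm₂ + (cm₃ + y₃) * cm₃))
      + (c₃ + cm₃) * y₁ * y₂ + (c₂ + cm₂) * y₁ * y₃ + (c₁ + cm₁) * y₂ * y₃ + (2 - p) * (y₁ * y₂ * y₃) := by ring
  rw [hrw]
  exact mul_nonneg (mul_nonneg hp₀ h1p) hB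

/-- **Automatic step, a single changing petal.**  If two of the three petal masses are unchanged across the coordinate
(`cm₂ = cp₂`, `cm₃ = cp₃`), the bracket equals `p(1−p)·Γ ≥ 0`. [this work] -/
theorem agPlus_bracket_nonneg_of_single_increment {b0 cm₁ d c₁ c₂ c₃ cp₁ cp₂ cp₃ a0 p : ℝ}
    (hcm₁ : 0 ≤ cm₁) (hd : 0 ≤ d) (hcp₁ : 0 ≤ cp₁) (hcp₂ : 0 ≤ cp₂) (hcp₃ : 0 ≤ cp₃) (hp₀ : 0 ≤ p) (hp₁ : p ≤ 1) :
    0 ≤ ((a0 + p * (d + cp₁ + cp₂ + cp₃)) * (b0 + (1 - p) * (d + cm₁ + cp₂ + cp₃))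
        - ((c₁ + p * cm₁ + (1 - p) * cp₁) * (c₂ + p * cp₂ + (1 - p) * cp₂)
            + (c₁ + p * cm₁ + (1 - p) * cp₁) * (c₃ + p * cp₃ + (1 - p) * cp₃)
            + (c₂ + p * cp₂ + (1 - p) * cp₂) * (c₃ + p * cp₃ + (1 - p) * cp₃))
        - (c₁ + p * cm₁ + (1 - p) * cp₁) * (c₂ + p * cp₂ + (1 - p) * cp₂) * (c₃ + p * cp₃ + (1 - p) * cp₃))
      - (1 - p) * (a0 * (b0 + d + cm₁ + cp₂ + cp₃)
          - ((c₁ + cp₁) * (c₂ + cp₂) + (c₁ + cp₁) * (c₃ + cp₃) + (c₂ + cp₂) * (c₃ + cp₃))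
          - (c₁ + cp₁) * (c₂ + cp₂) * (c₃ + cp₃))
      - p * ((a0 + d + cp₁ + cp₂ + cp₃) * b0
          - ((c₁ + cm₁) * (c₂ + cp₂) + (c₁ + cm₁) * (c₃ + cp₃) + (c₂ + cp₂) * (c₃ + cp₃))
          - (c₁ + cm₁) * (c₂ + cp₂) * (c₃ + cp₃)) := by
  have key := agPlus_coordinate_bracket b0 cm₁ cp₂ cp₃ d c₁ c₂ c₃ cp₁ cp₂ cp₃ a0 p
  rw [key]
  have h1p : 0 ≤ 1 - p := sub_nonneg.mpr hp₁
  have hrw : (d * d + d * (cp₁ + cp₂ + cp₃ + cm₁ + cp₂ + cp₃) + (cp₁ * cp₂ + cp₁ * cp₃ + cp₂ * cp₃)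
        + (cm₁ * cp₂ + cm₁ * cp₃ + cp₂ * cp₃) + (cp₁ * cm₁ + cp₂ * cp₂ + cp₃ * cp₃))
      + (c₃ + cp₃) * (cm₁ - cp₁) * (cp₂ - cp₂) + (c₂ + cp₂) * (cm₁ - cp₁) * (cp₃ - cp₃)
      + (c₁ + cp₁) * (cp₂ - cp₂) * (cp₃ - cp₃)
      + (1 + p) * ((cm₁ - cp₁) * (cp₂ - cp₂) * (cp₃ - cp₃))
      = d * d + d * (cp₁ + cp₂ + cp₃ + cm₁ + cp₂ + cp₃) + (cp₁ * cp₂ + cp₁ * cp₃ + cp₂ * cp₃)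
        + (cm₁ * cp₂ + cm₁ * cp₃ + cp₂ * cp₃) + (cp₁ * cm₁ + cp₂ * cp₂ + cp₃ * cp₃) := by ring
  rw [hrw]
  exact mul_nonneg (mul_nonneg hp₀ h1p) (gladkovGamma_nonneg hcm₁ hcp₂ hcp₃ hd hcp₁ hcp₂ hcp₃)

end Signs

end CoordinateBracket

end CubicThreePointStep

end Summit.CriticalPhenomena.PercolationContinuityZ3.Theorems
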